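/-
Copyright (c) 2026 the pub-hodgecm-mathlib formalisation cell (harness21).  R90-TF SLAB, section S10 (Rogawski 1990, §13.8 p. 219 L2–L3: «`ρ` unramified off `v`» ⇒ `ξ_H(ρ_w)`),
prover K2Liu-p13 (g5); DEAL #69 «`hPS` discharge-or-shrink» — ROAD (b) SHRINK TO LEVEL TRACES (dealer R90-C138-plan (g3) 03:08:04Z (2) ∕ 03:09:42Z; census
`R90/R90-C138-p13/CENSUS-DEAL69-hPS.p13-g5.md` 9eb93b61de319d9c); h413 = `stmt-HodgeConjecture-24833`, route `HCCMUnconditional`.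
-/
import Summits.HodgeConjecture.HodgeConjecture.Theorems.R90S10RigidityAtGermOfLetters          -- ★ p07: `hex` consumer shapes :255∕:282; ★ C2 `S10FrozenDatum`, `LiesOver`
import Summits.HodgeConjecture.HodgeConjecture.Theorems.R90S10PSLocalCharTransferPinnedLetters  -- ★ p864723 (p02): `exists_pinnedAt_of_abstractLetter`
import Summits.HodgeConjecture.HodgeConjecture.Theorems.R90S10SphericalConstituentTraceOfGerm   -- ★ p864629 (p02): `exists_liesOver_of_pinnedPartner`
import Summits.HodgeConjecture.HodgeConjecture.Theorems.R90S10SphericalConstituentTrace         -- ★ p863695: engine `smoothTrace_eq_of_isSpherical_isConstituentOf`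
import Summits.HodgeConjecture.HodgeConjecture.Theorems.R90S10UnramCharIdentityOfLetters        -- ★ p864554 (J) `psLocalCharTransferAbstractLetter_of_letters`
import Summits.HodgeConjecture.HodgeConjecture.Theorems.R90S10SplitHVanDijkLetterHolds          -- ★ p864651 (M-a) `splitHVanDijkLetter_holds` (unconditional)
import Summits.HodgeConjecture.HodgeConjecture.Theorems.R90S10SplitAbstractTransfer             -- ★ (p08) (M-b′) `splitAbstractTransferLetter_holds` (unconditional)
import HarnessLib

/-!
# R90-TF ∕ S10 — THE ROW-6 `hex` FAMILY FROM LEVEL TRACES: the keystone binder `hPS` SHRUNK to «`ρ_w` has the `K_H`-level traces of an unramified principal series»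
# (`Theorems/R90S10HexOfLevelTraces.lean`; ns `Summit.HodgeConjecture.HodgeConjecture.R90.S10`; THEOREMS ONLY, ★-only imports, 0 `sorry`)

THE PRINT.  [Rogawski1990, §13.8 p. 218 L9 (ii), p. 219 L2–L3]: `ρ` is unramified off `v`, and «`π_w = ξ_H(ρ_w)` for all `w ≠ v`»; `ξ_H(ρ_w)` is read off the SATAKE PARAMETER of
the unramified `ρ_w`, i.e. off the character by which `ℋ(H_w, K_{H,w})` acts on the spherical line — NOT off a realisation of `ρ_w` as a FULL principal series `i_H(χ₂ ⊠ χ₁)`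
(which may be reducible at unitary unramified data: `i_H(χ) = π⁺ ⊕ π⁻` on quasi-split `U(2)` when `χ|_{F×} = ω_{E∕F}` [§11.1]).  [CartierCorvallis1979, §IV.1 Thm. 4.1, Cor.
4.1–4.2]: an admissible representation with a LINE of `K`-fixed vectors acts on `C_c(K\G∕K)` through that line.

WHAT THIS FILE PROVES (road (b) of DEAL #69).  p01 (g0)'s ★-to-be (H1)(H2) `exists_liesOver_frozen_of_letters` ∕ `exists_eigenvaluePackage_hexFamily` produce p07's `hex` binder
from `hPS : ∀ w ≠ v, ∃ χ₂ χ₁, IsOpen χ₁.ker ∧ Nonempty ((𝔥.ρ w).Equiv (cmPrincipalSeriesH L w χ₂ χ₁)) ∧ finrank (𝔥.ρ w)^{K_H} = 1` («`ρ_w` IS a full unramified PS»).  KEY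
OBSERVATION: ★ C2 `LiesOver … π₀ ρ_w` (`R90S10FrozenDatumDefs` :187–:190) reads `ρ_w` ONLY through `ρ_w.smoothTrace ν fH` at `K_{H,w}`-LEVEL `fH`; and the ★ chain (J) (3′) → ★
`exists_pinnedAt_of_abstractLetter` → ★ `exists_liesOver_of_pinnedPartner` is GENERIC in `ρ_w`.  So we run the chain on `P := cmPrincipalSeriesH L w χ₂ χ₁` ITSELF (`Equiv.refl`) and
move the resulting `LiesOver … π₀ P` onto `𝔥.ρ w` along equality of LEVEL TRACES:
* §1 `liesOver_of_levelTrace_eq` — `(∀ fH, IsLocSmooth fH → IsLevel KHw fH → Tr ρw(fH) = Tr ρw′(fH)) → LiesOver … πw ρw′ → LiesOver … πw ρw` (+ `liesOver_congr_of_levelTrace_eq`).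
* §2 `levelTrace_eq_of_common_sphericalConstituent` — the socket through which the shrunk binder is later DISCHARGED: two admissible representations with `K`-LINES sharing a
  `K`-SPHERICAL CONSTITUENT have the same level-`K` traces (★ engine `smoothTrace_eq_of_isSpherical_isConstituentOf` twice) [Cartier IV Cor. 4.1–4.2].
* §3 (H1♭) `exists_liesOver_frozen_of_levelTraces_of_equiv` ∕ `exists_liesOver_frozen_of_levelTraces` — at the frozen datum `𝔣`, `w ≠ v`, under ⟪U⟫_w and `μ|_{𝕀_{L⁺}} = ω`:
  from `(χ₂, χ₁)` (`χ₁` smooth), a `K_{H,w}`-LINE of `P ≅ cmPrincipalSeriesH L w χ₂ χ₁` (any realisation ∕ the model itself) and the LEVEL-TRACE identity `Tr ρ_w(fH) = Tr P(fH)` (`fH` locally smooth of level `K_{H,w}`), SOME admissible `U(Φ₃)(𝒪_w)`-spherical class `π₀`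
  with spherical character `t_w` LIES OVER `ρ_w` — p01's (H1) road VERBATIM on `ρw := P` ((J) over ★ (M-a), ★ (M-b′), the frozen unit transfer `𝔳.htrf w`; ★ pin; ★ partner) + §1.
* §4 (H2♭) `exists_eigenvaluePackage_hexFamily_of_levelTraces` (+ `_of_subset`) — `choose` over `w ≠ v`: the binder `hex` of ★ `rigidityAtGermLetter_subtype_of_exists_liesOver`
  (resp. `rigidityAtGermLetter_of_exists_liesOver`) VERBATIM from the SHRUNK binder
  `hPS♭ : ∀ w ≠ v, ∃ χ₂ χ₁, IsOpen χ₁.ker ∧ finrank P^{K_{H,w}} = 1 ∧ ∀ fH, IsLocSmooth fH → IsLevel (𝔥.KH w) fH → Tr ρ_w(fH) = Tr P(fH)`, `P := cmPrincipalSeriesH L w χ₂ χ₁`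
  («the spherical constituent of `ρ_w` has
  Satake parameter `(χ₂, χ₁)`» — print-TRUE at every unramified `w`, whatever the reducibility of `P`; class (E1-c)⁺-local; its own discharge = Satake classification on `H_w` through §2).
HONEST LABEL: replaces the keystone binder `hPS` by the WEAKER, print-true `hPS♭`; pays `hex` modulo `hPS♭` + ⟪U⟫ + ⟪P⟫ only; HC_CM is proved only modulo the 7 printed citations
(2 remaining named inputs: hLiu418 = `stmt-HodgeConjecture-24832`, h413 = `stmt-HodgeConjecture-24833`) until rung 0 closes; REL ≠ ★ ≠ BUILT; supports-only lane.

## References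
* [Rogawski1990] J. D. Rogawski, *Automorphic Representations of Unitary Groups in Three Variables*, Ann. of Math. Stud. 123 (1990): §4.9 Lemma 4.9.2 pp. 55–56; §11.1
  p. 161; §12.1 p. 171; §13.6 p. 209; §13.8 p. 218 L9 (ii), p. 219 L2–L3.
* [CartierCorvallis1979] P. Cartier, *Representations of p-adic groups: a survey*, Proc. Sympos. Pure Math. 33 (1979), Part 1, §IV.1 Thm. 4.1, Cor. 4.1–4.2.
* [BorelJacquet1979] A. Borel, H. Jacquet, *Automorphic forms and automorphic representations*, Proc. Sympos. Pure Math. 33.1 (1979), §4.4.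
-/

set_option autoImplicit false
-- the mandated namespace has the single-problem summit's repeated segment (`HodgeConjecture.HodgeConjecture`)
set_option linter.dupNamespace false

noncomputable section

open scoped RestrictedProduct Matrix MatrixGroups
open Filter MeasureTheory NumberField IsDedekindDomain CompactlySupported
open Literature.NumberTheory.Rogawski1990 Literature.NumberTheory.Automorphic Literature.NumberTheory.Automorphic.UnitaryGroup
open Literature.NumberTheory.Automorphic.UnitaryGroup.CotangentForms Literature.NumberTheory.GaloisRepresentations
open Literature.NumberTheory.Automorphic.Arthur2013.Leaves.TECR
open Summit.HodgeConjecture.HodgeConjecture.Cruxes.H413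
open Summit.HodgeConjecture.HodgeConjecture.Cruxes.H413.K2E1TraceFormulaBeta
open Summit.HodgeConjecture.HodgeConjecture.Cruxes.H413.K2E1SpectralTermsDiscreteHalf
open Summit.HodgeConjecture.HodgeConjecture.Cruxes.H413.K2E1EvpOfAutomorphicClass

namespace Summit.HodgeConjecture.HodgeConjecture.R90.S10

/-! ## §1 `LiesOver` only reads `ρ_w` through its `K_{H,w}`-level traces -/

section LevelTrace

variable {L : Type} [Field L] [NumberField L] [IsCMField L] {μ : HeckeCharacter L} {w : Pl L}
  {_msH : MeasurableSpace (HLoc L w)} {_msG : MeasurableSpace (Gqs L w)}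
  {_qH : ∀ a : HLoc L w, MeasurableSpace (HLoc L w ⧸ Subgroup.centralizer ({a} : Set (HLoc L w)))}
  {_qQ : ∀ γ : Gqs L w, MeasurableSpace (Gqs L w ⧸ Subgroup.centralizer ({γ} : Set (Gqs L w)))}
  {KG : Subgroup (Gqs L w)} {KHw : Subgroup (HLoc L w)} {νQw : Measure (Gqs L w)} {νHw : Measure (HLoc L w)}
  {mHw : OrbitalMeasureFamily (HLoc L w)} {mQw : OrbitalMeasureFamily (Gqs L w)} {πw : IrrClass (Gqs L w)}
  {Vw : Type} {_acV : AddCommGroup Vw} {_mdV : Module ℂ Vw} {ρw : Representation ℂ (HLoc L w) Vw}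
  {Vw' : Type} {_acV' : AddCommGroup Vw'} {_mdV' : Module ℂ Vw'} {ρw' : Representation ℂ (HLoc L w) Vw'}

/-- **`LiesOver` transports along equality of `K_{H,w}`-LEVEL TRACES.**  If `Tr ρ_w(f^H) = Tr ρ′_w(f^H)` for every locally smooth `K_{H,w}`-bi-invariant `f^H`, then every class
lying over `ρ′_w` lies over `ρ_w`: ★ `LiesOver` (`R90S10FrozenDatumDefs` :187–:190) tests `ρ_w` only on `Δ_w`-matched pairs `(f^H, φ)` with `IsLevel KHw f^H` (and `MatchE1`'s first
conjunct `IsLocSmooth f^H`). [cite: Rogawski1990, §13.8 p. 219 L3; §4.9 Prop. 4.9.1 p. 55] [cite: CartierCorvallis1979, §IV.1 Cor. 4.1] -/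
theorem liesOver_of_levelTrace_eq
    (htr : ∀ fH : HLoc L w → ℂ, IsLocSmooth fH → IsLevel KHw fH → ρw.smoothTrace νHw fH = ρw'.smoothTrace νHw fH)
    (h : LiesOver L μ w KG KHw νQw νHw mHw mQw πw ρw') : LiesOver L μ w KG KHw νQw νHw mHw mQw πw ρw :=
  ⟨h.1, fun fH φ hfH hφ hM => (h.2 fH φ hfH hφ hM).trans (htr fH hM.1 hfH).symm⟩

/-- **… and conversely, so `LiesOver … πw ρ_w ↔ LiesOver … πw ρ′_w` for representations with the same level traces.** [cite: Rogawski1990, §13.8 p. 219 L3]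
[cite: CartierCorvallis1979, §IV.1 Cor. 4.1] -/
theorem liesOver_congr_of_levelTrace_eq
    (htr : ∀ fH : HLoc L w → ℂ, IsLocSmooth fH → IsLevel KHw fH → ρw.smoothTrace νHw fH = ρw'.smoothTrace νHw fH) :
    LiesOver L μ w KG KHw νQw νHw mHw mQw πw ρw ↔ LiesOver L μ w KG KHw νQw νHw mHw mQw πw ρw' :=
  ⟨liesOver_of_levelTrace_eq fun fH hfH hK => (htr fH hfH hK).symm, liesOver_of_levelTrace_eq htr⟩

end LevelTrace

/-! ## §2 The discharge socket: a common spherical constituent gives equal level traces -/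

section Constituent

variable {G : Type} [Group G] [TopologicalSpace G] [IsTopologicalGroup G] [MeasurableSpace G] [BorelSpace G]
  (ν : Measure G) [ν.IsMulLeftInvariant] [IsFiniteMeasureOnCompacts ν]

/-- **TWO ADMISSIBLE REPRESENTATIONS WITH `K`-LINES SHARING A `K`-SPHERICAL CONSTITUENT HAVE THE SAME LEVEL-`K` TRACES** — each acts on `C_c(K\G∕K)` through its `K`-line,
which is the `K`-line of the common spherical constituent `r` (★ `smoothTrace_eq_of_isSpherical_isConstituentOf`, twice).  At `G = H_w`, `ρ = ρ_w`, `P = i_H(χ₂ ⊠ χ₁)` with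
`r` the unramified constituent of `ρ_w` embedded in `P` (Satake classification) this DISCHARGES the shrunk binder `hPS♭` of §4. [cite: CartierCorvallis1979, §IV.1 Thm. 4.1,
Cor. 4.1–4.2] [cite: BorelJacquet1979, §4.4] [cite: Rogawski1990, §13.8 p. 219 L3] -/
theorem levelTrace_eq_of_common_sphericalConstituent {K : Subgroup G}
    {V : Type} [AddCommGroup V] [Module ℂ V] {ρ : Representation ℂ G V} (hadm : ρ.IsAdmissible) (hline : Module.finrank ℂ ↥(ρ.fixedPoints K) = 1)
    {W : Type} [AddCommGroup W] [Module ℂ W] {P : Representation ℂ G W} (hadmP : P.IsAdmissible) (hlineP : Module.finrank ℂ ↥(P.fixedPoints K) = 1)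
    {r : IrrClass G} (hsph : r.IsSpherical K) (hr : r.IsConstituentOf ρ) (hrP : r.IsConstituentOf P)
    {f : G → ℂ} (hf : IsLocSmooth f) (hfK : IsLevel K f) : ρ.smoothTrace ν f = P.smoothTrace ν f :=
  (smoothTrace_eq_of_isSpherical_isConstituentOf ν hadm hline hsph hr hf.2 hfK).symm.trans
    (smoothTrace_eq_of_isSpherical_isConstituentOf ν hadmP hlineP hsph hrP hf.2 hfK)

end Constituent

/-! ## §3 (H1♭) the `hex` witness at one place `w ≠ v` from LEVEL TRACES -/

section Frozen

variable {L : Type} [Field L] [NumberField L] [IsCMField L] [DecidableEq (Pl L)] {μ : HeckeCharacter L} {v : Pl L}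
  [MeasurableSpace (HLoc L v)] [BorelSpace (HLoc L v)] [MeasurableSpace (Gqs L v)] [BorelSpace (Gqs L v)]
  {νHv : Measure (HLoc L v)} {νQv : Measure (Gqs L v)} [νHv.IsHaarMeasure] [νHv.IsMulRightInvariant] [νQv.IsHaarMeasure] [νQv.IsMulRightInvariant]
  [∀ a : HLoc L v, MeasurableSpace (HLoc L v ⧸ Subgroup.centralizer ({a} : Set (HLoc L v)))]
  [∀ a : HLoc L v, BorelSpace (HLoc L v ⧸ Subgroup.centralizer ({a} : Set (HLoc L v)))]
  [∀ γ : Gqs L v, MeasurableSpace (Gqs L v ⧸ Subgroup.centralizer ({γ} : Set (Gqs L v)))]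
  [∀ γ : Gqs L v, BorelSpace (Gqs L v ⧸ Subgroup.centralizer ({γ} : Set (Gqs L v)))]
  {mHv : OrbitalMeasureFamily (HLoc L v)} {mQv : OrbitalMeasureFamily (Gqs L v)} {πSt : IrrClass (HLoc L v)}
  [MeasurableSpace (G3 L).Adelic] [BorelSpace (G3 L).Adelic] [MeasurableSpace (H2 L).Adelic] [BorelSpace (H2 L).Adelic]
  [MeasurableSpace (GArch L)] [BorelSpace (GArch L)] [MeasurableSpace (HArch L)] [BorelSpace (HArch L)]
  [MeasurableSpace (H1Loc L v)] [MeasurableSpace (H1Arch L)] [MeasurableSpace (H1 L).Adelic] [BorelSpace (H1 L).Adelic]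

/-- **(H1♭) THE `hex` WITNESS AT ONE PLACE `w ≠ v` FROM LEVEL TRACES** — at the frozen datum, for `μ|_{𝕀_{L⁺}} = ω`, ⟪U⟫ at `w`, an inducing pair `(χ₂, χ₁)` (`χ₁` smooth) whose
principal series in ANY realisation `P ≅ i_H(χ₂ ⊠ χ₁)` (★ `cmPrincipalSeriesH`) has a `K_{H,w}`-LINE, and `ρ_w` with THE SAME `K_{H,w}`-LEVEL TRACES AS `P`: SOME admissible `U(Φ₃)(𝒪_w)`-spherical
class `π₀` with spherical character `t_w` LIES OVER `ρ_w`.  PROOF = p01 (g0)'s (H1) road run on `ρw := P` (`Equiv.refl`): (3′) by ★ (J) over the unconditional ★ (M-a)∕(M-b′) and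
the frozen unit transfer `𝔳.htrf w`; the pin ★ `exists_pinnedAt_of_abstractLetter`; the class ★ `exists_liesOver_of_pinnedPartner` (lying over `P`); then §1 moves it onto `ρ_w`.
[cite: Rogawski1990, §13.8 p. 219 L2–L3; §4.9 Lemma 4.9.2 pp. 55–56; §13.6 p. 209] [cite: CartierCorvallis1979, §IV.1 Cor. 4.1–4.2] -/
theorem exists_liesOver_frozen_of_levelTraces_of_equiv
    (hμω : ∀ x : Literature.NumberTheory.GaloisRepresentations.ideleGroup ↥(maximalRealSubfield L),
      μ (AdeleRing.ideleBaseChange (↥(maximalRealSubfield L)) L x) = quadraticHeckeCharCM L x)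
    (𝔣 : S10FrozenDatum L μ v νHv νQv mHv mQv πSt) (w : {w : Pl L // w ≠ v})
    (hU : ∀ W : PlacesOver L w.1, Algebra.IsUnramifiedAt (𝓞 ↥(maximalRealSubfield L)) W.1.asIdeal ∧ μ.IsUnramifiedAt W.1)
    (χ₂ : ↥(torusU (conjLocal L (IsCMField.complexConj L) w.1) (cmLocalForm L 2 w.1)) →* ℂˣ) (χ₁ : H1Loc L w.1 →* ℂˣ)
    (hχ₁ : IsOpen ((χ₁.ker : Subgroup (H1Loc L w.1)) : Set (H1Loc L w.1)))
    {VP : Type} [AddCommGroup VP] [Module ℂ VP] (P : Representation ℂ (HLoc L w.1) VP) (hP : Nonempty (P.Equiv (cmPrincipalSeriesH L w.1 χ₂ χ₁)))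
    (hlineP : Module.finrank ℂ ↥(P.fixedPoints (𝔣.𝔥.KH w.1)) = 1)
    (htr : letI := 𝔣.𝔥.acV w.1
      letI := 𝔣.𝔥.mdV w.1
      letI := 𝔣.𝔳.msH w
      ∀ fH : HLoc L w.1 → ℂ, IsLocSmooth fH → IsLevel (𝔣.𝔥.KH w.1) fH →
        (𝔣.𝔥.ρ w.1).smoothTrace (𝔣.𝔳.νHw w) fH = P.smoothTrace (𝔣.𝔳.νHw w) fH) :
    ∃ tw : heckeAlgebra ℂ (Gqs L w.1) (cmLocalIntegralLevel L 3 (qsForm L) w.1) →ₐ[ℂ] ℂ,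
      ∃ π₀ : IrrClass (Gqs L w.1), π₀.IsAdmissible ∧ ∃ h₀ : π₀.IsSpherical (cmLocalIntegralLevel L 3 (qsForm L) w.1),
        unopClassSphericalCharacter (cmLocalIntegralLevel L 3 (qsForm L) w.1) π₀ h₀ = tw ∧
          LiesOver L μ w.1 (𝔣.𝔳.K w.1) (𝔣.𝔥.KH w.1) (𝔣.𝔳.νQ w) (𝔣.𝔳.νHw w) (𝔣.𝔳.mH w) (𝔣.𝔳.mQ w) π₀ (𝔣.𝔥.ρ w.1) := by
  letI := 𝔣.𝔳.msG w
  letI := 𝔣.𝔳.msH w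
  haveI := 𝔣.𝔳.bsG w
  haveI := 𝔣.𝔳.bsH w
  letI := 𝔣.𝔳.qH w
  letI := 𝔣.𝔳.qQ w
  haveI := 𝔣.𝔳.bqH w
  haveI := 𝔣.𝔳.bqQ w
  haveI := 𝔣.𝔳.hνQ w
  haveI := 𝔣.𝔳.hνQr w
  haveI := 𝔣.𝔳.hνHw w
  haveI := 𝔣.𝔳.hνHwr w
  letI := 𝔣.𝔥.acV w.1
  letI := 𝔣.𝔥.mdV w.1
  -- the level pins off `v`
  have hKG : 𝔣.𝔳.K w.1 = cmLocalIntegralLevel L 3 (qsForm L) w.1 := 𝔣.𝔳.hKstd w.1 w.2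
  have hKH : 𝔣.𝔥.KH w.1 = (cmLocalIntegralLevel L 2 (Matrix.of fun i j : Fin 2 => if i.val + j.val + 1 = 2 then (1 : L) else 0) w.1).prod
      (cmLocalIntegralLevel L 1 (Matrix.of fun i j : Fin 1 => if i.val + j.val + 1 = 1 then (1 : L) else 0) w.1) := by
    rw [𝔣.𝔥.hKH w.1, 𝔣.𝔥.hK₂std w.1 w.2, 𝔣.𝔥.hK₁std w.1 w.2]
  -- the unit volumes (frozen normalisations)
  have hvolH : 𝔣.𝔳.νHw w (𝔣.𝔥.KH w.1 : Set (HLoc L w.1)) = 1 :=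
    (ENNReal.toReal_eq_one_iff _).1 (by rw [← measureReal_def]; exact 𝔣.𝔳.hνHK w)
  have hvolG : 𝔣.𝔳.νQ w (cmLocalIntegralLevel L 3 (qsForm L) w.1 : Set (Gqs L w.1)) = 1 :=
    (ENNReal.toReal_eq_one_iff _).1 (by rw [← measureReal_def, ← hKG]; exact 𝔣.𝔳.hνQK w)
  -- the frozen unit transfer IS the unit identity at the standard levels
  have hUT : IsLocalUnitTransfer L (qsForm L) w.1 ((finExplicitCollection L (qsForm L) μ (finExplicitDelta_conj_left_all L (qsForm L) μ)
      (finExplicitDelta_conj_right_all L (qsForm L) μ)) w.1) (𝔣.𝔳.mH w) (𝔣.𝔳.mQ w) := by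
    have h := 𝔣.𝔳.htrf w
    rw [hKH, hKG] at h
    exact h
  -- (3′) at the frozen data, by the junction (J) over (M-a), (M-b′) ★ and the frozen unit transfer
  have h3 : PSLocalCharTransferAbstractLetter L μ w.1 (cmLocalIntegralLevel L 3 (qsForm L) w.1) (𝔣.𝔥.KH w.1) (𝔣.𝔳.νQ w) (𝔣.𝔳.νHw w)
      (𝔣.𝔳.mH w) (𝔣.𝔳.mQ w) :=
    psLocalCharTransferAbstractLetter_of_letters L μ w.1 (cmLocalIntegralLevel L 3 (qsForm L) w.1) (𝔣.𝔥.KH w.1) (𝔣.𝔳.νQ w) (𝔣.𝔳.νHw w)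
      (𝔣.𝔳.mH w) (𝔣.𝔳.mQ w) (splitHVanDijkLetter_holds L w.1 μ (𝔣.𝔳.νHw w) (𝔣.𝔳.mH w) (𝔣.𝔳.mQ w))
      (splitAbstractTransferLetter_holds L μ w.1 (𝔣.𝔳.νQ w) (𝔣.𝔳.νHw w)) (fun _ _ _ _ => hUT) hμω (𝔣.𝔳.hmH w) (𝔣.𝔳.hmQ w)
  -- the partner of the PRINCIPAL SERIES ITSELF, pinned at its own parameter, and the class lying over `P`
  obtain ⟨tw, W, _, _, I, hI, ⟨hlineI, hIt⟩, hβI⟩ := exists_pinnedAt_of_abstractLetter L μ w.1 (cmLocalIntegralLevel L 3 (qsForm L) w.1) (𝔣.𝔥.KH w.1)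
    (𝔣.𝔳.νQ w) (𝔣.𝔳.νHw w) (𝔣.𝔳.mH w) (𝔣.𝔳.mQ w) h3 hU rfl hKH hvolH hvolG χ₂ χ₁ hχ₁ P hP hlineP
  have hK := isCompact_isOpen_cmLocalIntegralLevel L 3 (qsForm L) w.1
  obtain ⟨π₀, hadm₀, h₀, hπt, hLOP⟩ := exists_liesOver_of_pinnedPartner L μ w.1 (cmLocalIntegralLevel L 3 (qsForm L) w.1) (𝔣.𝔥.KH w.1) (𝔣.𝔳.νQ w) (𝔣.𝔳.νHw w)
    (𝔣.𝔳.mH w) (𝔣.𝔳.mQ w) hK.2 hK.1 tw P I hI hlineI hIt hβI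
  -- move the fibre condition from `P` onto `ρ_w` along the level traces
  refine ⟨tw, π₀, hadm₀, h₀, hπt, ?_⟩
  rw [hKG]
  exact liesOver_of_levelTrace_eq htr hLOP

/-- **(H1♭) AT THE MODEL `P = cmPrincipalSeriesH L w χ₂ χ₁` ITSELF** (`Equiv.refl`): the `hex` witness at `w ≠ v` from a `K_{H,w}`-line of the model principal series and the
level-trace identity `Tr ρ_w(f^H) = Tr i_H(χ₂ ⊠ χ₁)(f^H)` on locally smooth `K_{H,w}`-bi-invariant `f^H` — the per-place body of the shrunk binder `hPS♭`.
[cite: Rogawski1990, §13.8 p. 219 L2–L3; §4.9 Lemma 4.9.2 pp. 55–56; §13.6 p. 209] [cite: CartierCorvallis1979, §IV.1 Cor. 4.1–4.2] -/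
theorem exists_liesOver_frozen_of_levelTraces
    (hμω : ∀ x : Literature.NumberTheory.GaloisRepresentations.ideleGroup ↥(maximalRealSubfield L),
      μ (AdeleRing.ideleBaseChange (↥(maximalRealSubfield L)) L x) = quadraticHeckeCharCM L x)
    (𝔣 : S10FrozenDatum L μ v νHv νQv mHv mQv πSt) (w : {w : Pl L // w ≠ v})
    (hU : ∀ W : PlacesOver L w.1, Algebra.IsUnramifiedAt (𝓞 ↥(maximalRealSubfield L)) W.1.asIdeal ∧ μ.IsUnramifiedAt W.1)
    (χ₂ : ↥(torusU (conjLocal L (IsCMField.complexConj L) w.1) (cmLocalForm L 2 w.1)) →* ℂˣ) (χ₁ : H1Loc L w.1 →* ℂˣ)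
    (hχ₁ : IsOpen ((χ₁.ker : Subgroup (H1Loc L w.1)) : Set (H1Loc L w.1)))
    (hlineP : Module.finrank ℂ ↥((cmPrincipalSeriesH L w.1 χ₂ χ₁).fixedPoints (𝔣.𝔥.KH w.1)) = 1)
    (htr : letI := 𝔣.𝔥.acV w.1
      letI := 𝔣.𝔥.mdV w.1
      letI := 𝔣.𝔳.msH w
      ∀ fH : HLoc L w.1 → ℂ, IsLocSmooth fH → IsLevel (𝔣.𝔥.KH w.1) fH →
        (𝔣.𝔥.ρ w.1).smoothTrace (𝔣.𝔳.νHw w) fH = (cmPrincipalSeriesH L w.1 χ₂ χ₁).smoothTrace (𝔣.𝔳.νHw w) fH) :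
    ∃ tw : heckeAlgebra ℂ (Gqs L w.1) (cmLocalIntegralLevel L 3 (qsForm L) w.1) →ₐ[ℂ] ℂ,
      ∃ π₀ : IrrClass (Gqs L w.1), π₀.IsAdmissible ∧ ∃ h₀ : π₀.IsSpherical (cmLocalIntegralLevel L 3 (qsForm L) w.1),
        unopClassSphericalCharacter (cmLocalIntegralLevel L 3 (qsForm L) w.1) π₀ h₀ = tw ∧
          LiesOver L μ w.1 (𝔣.𝔳.K w.1) (𝔣.𝔥.KH w.1) (𝔣.𝔳.νQ w) (𝔣.𝔳.νHw w) (𝔣.𝔳.mH w) (𝔣.𝔳.mQ w) π₀ (𝔣.𝔥.ρ w.1) :=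
  exists_liesOver_frozen_of_levelTraces_of_equiv hμω 𝔣 w hU χ₂ χ₁ hχ₁ (cmPrincipalSeriesH L w.1 χ₂ χ₁) ⟨Representation.Equiv.refl _⟩ hlineP htr

/-! ## §4 (H2♭) the keystone's `hex` family with its package, from the SHRUNK binder `hPS♭` -/

/-- **(H2♭) THE KEYSTONE'S `hex` FAMILY WITH ITS PACKAGE (`S = {v}`) FROM THE SHRUNK BINDER** — choice over `w ≠ v` in (H1♭): an e.v.p. package `t₀` off `v` at the standard levels and,
at every `w ≠ v`, an admissible spherical class of character `(t₀)_w` lying over `ρ_w` — the binder `hex` of ★ `rigidityAtGermLetter_subtype_of_exists_liesOver` VERBATIM, modulo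
⟪U⟫ off `v`, `μ|_{𝕀_{L⁺}} = ω` and the LEVEL-TRACE letter `hPS♭` («the spherical constituent of `ρ_w` has Satake parameter `(χ₂, χ₁)`»; print-true at every unramified `w`).
[cite: Rogawski1990, §13.8 p. 219 L2–L3; §13.6 p. 209; §12.1 p. 171] [cite: CartierCorvallis1979, §IV.1 Thm. 4.1, Cor. 4.1–4.2] -/
theorem exists_eigenvaluePackage_hexFamily_of_levelTraces
    (hunr : ∀ w : Pl L, w ≠ v → ∀ W : PlacesOver L w, Algebra.IsUnramifiedAt (𝓞 ↥(maximalRealSubfield L)) W.1.asIdeal ∧ μ.IsUnramifiedAt W.1)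
    (hμω : ∀ x : Literature.NumberTheory.GaloisRepresentations.ideleGroup ↥(maximalRealSubfield L),
      μ (AdeleRing.ideleBaseChange (↥(maximalRealSubfield L)) L x) = quadraticHeckeCharCM L x)
    (𝔣 : S10FrozenDatum L μ v νHv νQv mHv mQv πSt)
    (hPS : ∀ w : {w : Pl L // w ≠ v}, ∃ (χ₂ : ↥(torusU (conjLocal L (IsCMField.complexConj L) w.1) (cmLocalForm L 2 w.1)) →* ℂˣ) (χ₁ : H1Loc L w.1 →* ℂˣ),
      IsOpen ((χ₁.ker : Subgroup (H1Loc L w.1)) : Set (H1Loc L w.1)) ∧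
        Module.finrank ℂ ↥((cmPrincipalSeriesH L w.1 χ₂ χ₁).fixedPoints (𝔣.𝔥.KH w.1)) = 1 ∧
          (letI := 𝔣.𝔥.acV w.1
           letI := 𝔣.𝔥.mdV w.1
           letI := 𝔣.𝔳.msH w
           ∀ fH : HLoc L w.1 → ℂ, IsLocSmooth fH → IsLevel (𝔣.𝔥.KH w.1) fH →
             (𝔣.𝔥.ρ w.1).smoothTrace (𝔣.𝔳.νHw w) fH = (cmPrincipalSeriesH L w.1 χ₂ χ₁).smoothTrace (𝔣.𝔳.νHw w) fH)) :
    ∃ t₀ : Ch13Sec6.EigenvaluePackage ({v} : Set (Pl L)) fun w => heckeAlgebra ℂ (Gqs L w) (cmLocalIntegralLevel L 3 (qsForm L) w),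
      ∀ w : {w : Pl L // w ≠ v}, ∃ π₀ : IrrClass (Gqs L w.1), π₀.IsAdmissible ∧ ∃ h₀ : π₀.IsSpherical (cmLocalIntegralLevel L 3 (qsForm L) w.1),
        unopClassSphericalCharacter (cmLocalIntegralLevel L 3 (qsForm L) w.1) π₀ h₀ = t₀ ⟨w.1, fun h => w.2 (Set.mem_singleton_iff.1 h)⟩ ∧
          LiesOver L μ w.1 (𝔣.𝔳.K w.1) (𝔣.𝔥.KH w.1) (𝔣.𝔳.νQ w) (𝔣.𝔳.νHw w) (𝔣.𝔳.mH w) (𝔣.𝔳.mQ w) π₀ (𝔣.𝔥.ρ w.1) := by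
  have key : ∀ w : {w : Pl L // w ≠ v}, ∃ tw : heckeAlgebra ℂ (Gqs L w.1) (cmLocalIntegralLevel L 3 (qsForm L) w.1) →ₐ[ℂ] ℂ,
      ∃ π₀ : IrrClass (Gqs L w.1), π₀.IsAdmissible ∧ ∃ h₀ : π₀.IsSpherical (cmLocalIntegralLevel L 3 (qsForm L) w.1),
        unopClassSphericalCharacter (cmLocalIntegralLevel L 3 (qsForm L) w.1) π₀ h₀ = tw ∧
          LiesOver L μ w.1 (𝔣.𝔳.K w.1) (𝔣.𝔥.KH w.1) (𝔣.𝔳.νQ w) (𝔣.𝔳.νHw w) (𝔣.𝔳.mH w) (𝔣.𝔳.mQ w) π₀ (𝔣.𝔥.ρ w.1) := fun w => by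
    obtain ⟨χ₂, χ₁, hχ₁, hlineP, htr⟩ := hPS w
    exact exists_liesOver_frozen_of_levelTraces hμω 𝔣 w (hunr w.1 w.2) χ₂ χ₁ hχ₁ hlineP htr
  choose t ht using key
  exact ⟨fun i => t ⟨i.1, fun h => i.2 (Set.mem_singleton_iff.2 h)⟩, fun w => ht w⟩

/-- **THE SAME FAMILY, `S`-INDEXED (`v ∈ S`)** — the binder `hex` of ★ `rigidityAtGermLetter_of_exists_liesOver` VERBATIM (package indexed by `{w // w ∉ S}`), from the shrunk
binder `hPS♭`. [cite: Rogawski1990, §13.8 p. 219 L2–L3; §13.6 p. 209] [cite: CartierCorvallis1979, §IV.1 Cor. 4.1–4.2] -/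
theorem exists_eigenvaluePackage_hexFamily_of_levelTraces_of_subset
    (hunr : ∀ w : Pl L, w ≠ v → ∀ W : PlacesOver L w, Algebra.IsUnramifiedAt (𝓞 ↥(maximalRealSubfield L)) W.1.asIdeal ∧ μ.IsUnramifiedAt W.1)
    (hμω : ∀ x : Literature.NumberTheory.GaloisRepresentations.ideleGroup ↥(maximalRealSubfield L),
      μ (AdeleRing.ideleBaseChange (↥(maximalRealSubfield L)) L x) = quadraticHeckeCharCM L x)
    (𝔣 : S10FrozenDatum L μ v νHv νQv mHv mQv πSt) (S : Set (Pl L)) (hv : v ∈ S)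
    (hPS : ∀ w : {w : Pl L // w ≠ v}, ∃ (χ₂ : ↥(torusU (conjLocal L (IsCMField.complexConj L) w.1) (cmLocalForm L 2 w.1)) →* ℂˣ) (χ₁ : H1Loc L w.1 →* ℂˣ),
      IsOpen ((χ₁.ker : Subgroup (H1Loc L w.1)) : Set (H1Loc L w.1)) ∧
        Module.finrank ℂ ↥((cmPrincipalSeriesH L w.1 χ₂ χ₁).fixedPoints (𝔣.𝔥.KH w.1)) = 1 ∧
          (letI := 𝔣.𝔥.acV w.1
           letI := 𝔣.𝔥.mdV w.1
           letI := 𝔣.𝔳.msH w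
           ∀ fH : HLoc L w.1 → ℂ, IsLocSmooth fH → IsLevel (𝔣.𝔥.KH w.1) fH →
             (𝔣.𝔥.ρ w.1).smoothTrace (𝔣.𝔳.νHw w) fH = (cmPrincipalSeriesH L w.1 χ₂ χ₁).smoothTrace (𝔣.𝔳.νHw w) fH)) :
    ∃ t₀ : Ch13Sec6.EigenvaluePackage S fun w => heckeAlgebra ℂ (Gqs L w) (cmLocalIntegralLevel L 3 (qsForm L) w),
      ∀ (w : {w : Pl L // w ≠ v}) (hwS : w.1 ∉ S), ∃ π₀ : IrrClass (Gqs L w.1), π₀.IsAdmissible ∧ ∃ h₀ : π₀.IsSpherical (cmLocalIntegralLevel L 3 (qsForm L) w.1),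
        unopClassSphericalCharacter (cmLocalIntegralLevel L 3 (qsForm L) w.1) π₀ h₀ = t₀ ⟨w.1, hwS⟩ ∧
          LiesOver L μ w.1 (𝔣.𝔳.K w.1) (𝔣.𝔥.KH w.1) (𝔣.𝔳.νQ w) (𝔣.𝔳.νHw w) (𝔣.𝔳.mH w) (𝔣.𝔳.mQ w) π₀ (𝔣.𝔥.ρ w.1) := by
  have key : ∀ w : {w : Pl L // w ≠ v}, ∃ tw : heckeAlgebra ℂ (Gqs L w.1) (cmLocalIntegralLevel L 3 (qsForm L) w.1) →ₐ[ℂ] ℂ,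
      ∃ π₀ : IrrClass (Gqs L w.1), π₀.IsAdmissible ∧ ∃ h₀ : π₀.IsSpherical (cmLocalIntegralLevel L 3 (qsForm L) w.1),
        unopClassSphericalCharacter (cmLocalIntegralLevel L 3 (qsForm L) w.1) π₀ h₀ = tw ∧
          LiesOver L μ w.1 (𝔣.𝔳.K w.1) (𝔣.𝔥.KH w.1) (𝔣.𝔳.νQ w) (𝔣.𝔳.νHw w) (𝔣.𝔳.mH w) (𝔣.𝔳.mQ w) π₀ (𝔣.𝔥.ρ w.1) := fun w => by
    obtain ⟨χ₂, χ₁, hχ₁, hlineP, htr⟩ := hPS w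
    exact exists_liesOver_frozen_of_levelTraces hμω 𝔣 w (hunr w.1 w.2) χ₂ χ₁ hχ₁ hlineP htr
  choose t ht using key
  exact ⟨fun i => t ⟨i.1, fun h => i.2 (h ▸ hv)⟩, fun w _ => ht w⟩

end Frozen

end Summit.HodgeConjecture.HodgeConjecture.R90.S10

end
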